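import Literature.NumberTheory.GaloisRepresentations.ResidualHypothesesVSplit
import Literature.NumberTheory.GaloisRepresentations.InducedResiduallyAbsIrreducible
import Literature.NumberTheory.GaloisRepresentations.FramedRepTwist
import Literature.NumberTheory.GaloisRepresentations.LAdicCharacterUnramifiedAEProofs
import HarnessLib

/-!
# Residual absolute irreducibility under unit-valued twists; reductions on `Γ_{F(ζ_p)}`;
# `±1` are not residually congruent

Topic `Literature/NumberTheory/GaloisRepresentations`.  Theorem-only file (no definition, no named
fact) supplying three pieces of residual bookkeeping for hypothesis (4)
"`(Ind_{G_E}^{G_K} r̄)|_{G_{K(ζ_l)}}` absolutely irreducible" of the potential-automorphy theorems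
(Barnet-Lamb–Gee–Geraghty–Taylor 2014, Thm. C) applied to a *twisted* quadratic induction, on top
of `InducedResiduallyAbsIrreducible` / `MackeyInducedIrreducible`:

* `FramedRep.norm_apply_eq_one_of_compactSpace_normedField`,
  `FramedRep.HasAbsolutelyIrreducibleReduction.twist`
  — a continuous character of a compact group is unit-valued, and **twisting by a unit-valued
  character preserves the Burnside form of "absolutely irreducible reduction"**
  (`AbsolutelyIrreducibleReduction`; same frame, same `n²` elements: the rows of the `n² × n²`
  matrix get multiplied by units), hence residual absolute irreducibility
  (`hasAbsolutelyIrreducibleReduction_iff_isResiduallyAbsIrreducible`) — for an ARBITRARY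
  continuous `χ`, complementing the residually-trivial case of `ResidualRepTwist`;
* `FramedGaloisRep.exists_isReductionOf_isOpen_ker`,
  `FramedGaloisRep.isResiduallyAbsIrreducible_restrictField_iff_isAbsIrreducible_comp_subtype` —
  every `ρ : Γ_F → GL_n(ℚ̄_p)` has a reduction `τ` with open kernel, and **`ρ|Γ_L` is residually
  absolutely irreducible iff `τ|Γ_{F(ζ_p)}` is absolutely irreducible** for any model `L` of
  `F(ζ_p)` (the bridge between the `restrictField (CyclotomicField p F)` phrasing of the routes and
  the `absGaloisGroupAdjoinRootsOfUnity` phrasing of `ResidualHypothesesVSplit`);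
* `FramedRep.not_isResiduallyCongruent_of_apply_eq_neg_one` — in `GL₂(ℚ̄_p)`, `p` odd, `ρ(σ) = -1`
  and `ρ'(σ) = 1` forbid residual congruence (`(X+1)² ≢ (X-1)² mod 𝔪`).

## References

* H. Darmon, F. Diamond, R. Taylor, *Fermat's Last Theorem* (1995), §2.1. [DarmonDiamondTaylor1995]
* C. W. Curtis, I. Reiner, *Representation theory of finite groups and associative algebras*
  (1962), (27.4) (Burnside). [folklore]
* T. Barnet-Lamb, T. Gee, D. Geraghty, R. Taylor, Ann. of Math. 179 (2014), Thm. C (4).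
  [BarnetlambEtAl2014]
-/

noncomputable section

open scoped NumberField MatrixGroups
open NumberField IsDedekindDomain Field Filter Matrix IsLocalRing

namespace Literature.NumberTheory.GaloisRepresentations

/-! ### Burnside form under unit-valued twists -/

namespace FramedRep

variable {Γ : Type*} [Group Γ] [TopologicalSpace Γ] {K : Type*} [NormedField K] {n : ℕ}

/-- The values of a continuous character of a compact group in a normed field have norm `1`
(the image of `‖χ‖` is a bounded subgroup of `ℝ_{>0}`). [folklore] -/
theorem norm_apply_eq_one_of_compactSpace_normedField [CompactSpace Γ] (χ : Γ →ₜ* Kˣ) (σ : Γ) :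
    ‖(χ σ : K)‖ = 1 := by
  -- adapted from `ContinuousMonoidHom.norm_apply_eq_one` (`PadicCharacterCyclotomicFactorProofs`)
  have hc : Continuous fun τ : Γ ↦ ‖(χ τ : K)‖ :=
    continuous_norm.comp (Units.continuous_val.comp χ.continuous)
  obtain ⟨M, hM⟩ := (isCompact_range hc).isBounded.bddAbove
  have hle : ∀ τ : Γ, ‖(χ τ : K)‖ ≤ 1 := fun τ => not_lt.mp fun hlt => by
    obtain ⟨m, hm⟩ := pow_unbounded_of_one_lt M hlt
    have hm' : ‖(χ τ : K)‖ ^ m ≤ M := by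
      have := hM (Set.mem_range_self (τ ^ m))
      simpa only [map_pow, Units.val_pow_eq_pow_val, norm_pow] using this
    exact absurd hm' (not_le.mpr hm)
  refine le_antisymm (hle σ) ?_
  have h1 := hle σ⁻¹
  rw [map_inv, Units.val_inv_eq_inv_val, norm_inv] at h1
  exact (inv_le_one₀ (norm_pos_iff.mpr (Units.ne_zero _))).mp h1

/-- **Twisting by a unit-valued character preserves the Burnside form of "absolutely irreducible
reduction".**  If `ρ : Γ → GL_n(K)` has absolutely irreducible reduction (frame `g`, elements
`s a`) and `χ : Γ → Kˣ` is continuous with `‖χ(σ)‖ = 1` for all `σ`, then so does `ρ ⊗ χ`, with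
the same frame and the same elements: `g (ρ ⊗ χ)(σ) g⁻¹ = χ(σ) · g ρ(σ) g⁻¹` is still integral,
and the `n² × n²` matrix of entries of the `g (ρ ⊗ χ)(s a) g⁻¹` is obtained from that of `ρ` by
multiplying the `a`-th row by the unit `χ(s a)`, so its determinant is still a unit. [folklore] -/
theorem HasAbsolutelyIrreducibleReduction.twist {ρ : FramedRep Γ K n}
    (h : ρ.HasAbsolutelyIrreducibleReduction) (χ : Γ →ₜ* Kˣ) (hχ : ∀ σ, ‖(χ σ : K)‖ = 1) :
    (ρ.twist χ).HasAbsolutelyIrreducibleReduction := by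
  obtain ⟨g, s, hint, hdet⟩ := h
  have key : ∀ (σ : Γ) (i j : Fin n),
      ((g * ρ.twist χ σ * g⁻¹ : GL (Fin n) K) : Matrix (Fin n) (Fin n) K) i j =
        (χ σ : K) * ((g * ρ σ * g⁻¹ : GL (Fin n) K) : Matrix (Fin n) (Fin n) K) i j := by
    intro σ i j
    rw [conj_twist_apply, Units.val_mul, coe_scalar_apply, ← Algebra.smul_def, Matrix.smul_apply,
      smul_eq_mul]
  refine ⟨g, s, fun σ i j => ?_, ?_⟩
  · rw [key, norm_mul, hχ, one_mul]
    exact hint σ i j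
  · have hM : (Matrix.of fun a b : Fin n × Fin n =>
        ((g * ρ.twist χ (s a) * g⁻¹ : GL (Fin n) K) : Matrix (Fin n) (Fin n) K) b.1 b.2) =
        Matrix.of fun a b : Fin n × Fin n => (χ (s a) : K) *
          (Matrix.of fun a b : Fin n × Fin n =>
            ((g * ρ (s a) * g⁻¹ : GL (Fin n) K) : Matrix (Fin n) (Fin n) K) b.1 b.2) a b := by
      ext a b
      rw [Matrix.of_apply, Matrix.of_apply, Matrix.of_apply, key]
    rw [hM, Matrix.det_mul_column, norm_mul, hdet, mul_one, norm_prod, Finset.prod_eq_one]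
    intro a _
    exact hχ (s a)

end FramedRep

/-! ### Reductions restricted to `Γ_{F(ζ_p)}` -/

section Residual

universe u

variable {F : Type u} [Field F] [CharZero F] {p : ℕ} [Fact p.Prime] {n : ℕ}

/-- **Every continuous `ρ : Γ_F → GL_n(ℚ̄_p)` has a reduction `τ : Γ_F → GL_n(ℤ̄_p/𝔪)` with open
kernel**: an integral model `ρ₀ = P⁻¹ ρ P` over the (open, non-Noetherian) valuation ring `ℤ̄_p`
exists (`exists_integralModel_of_valuationSubring`), its reduction is a reduction of `ρ`, and
reductions have open kernel (`FramedGaloisRep.isOpen_ker_of_isReductionOf`, Deligne–Serre).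
[cite: DarmonDiamondTaylor1995, §2.1, p. 54] -/
theorem FramedGaloisRep.exists_isReductionOf_isOpen_ker (ρ : FramedGaloisRep F (PadicAlgCl p) n) :
    ∃ τ : absoluteGaloisGroup F →* GL (Fin n) (padicAlgClResidueField p),
      ρ.IsReductionOf (RingHom.id _) τ ∧ IsOpen (τ.ker : Set (absoluteGaloisGroup F)) := by
  obtain ⟨P, ρ₀, hP⟩ := exists_integralModel_of_valuationSubring (O := padicAlgClIntegers p)
    (Valued.isOpen_valuationSubring _) ρ
  have hred : ρ.IsReductionOf (RingHom.id _) (integralReduction (RingHom.id _) ρ₀) :=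
    ⟨ρ₀, 1, ⟨P, hP⟩, fun g => by rw [one_mul, inv_one, mul_one]⟩
  exact ⟨_, hred, FramedGaloisRep.isOpen_ker_of_isReductionOf hred⟩

/-- Absolute irreducibility only depends on the image: `τ(Γ') ⊆ σ(Γ)` and `τ` absolutely
irreducible imply `σ` absolutely irreducible (local copy of `IsAbsIrreducible.of_range_le` of
`Automorphic/CaraianiNewtonResidualImageModularity`, whose import cone is not wanted here; from
`isIrreducible_glRepresentation_of_range_le`). [folklore] -/
private theorem isAbsIrreducible_of_range_le' {Γ Γ' : Type*} [Group Γ] [Group Γ'] {k : Type*} [Field k]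
    {m : ℕ} {τ : Γ' →* GL (Fin m) k} {σ : Γ →* GL (Fin m) k} (hτ : IsAbsIrreducible τ)
    (h : τ.range ≤ σ.range) : IsAbsIrreducible σ := by
  intro k' _ f
  refine isIrreducible_glRepresentation_of_range_le (hτ k' f) ?_
  rw [MonoidHom.range_comp, MonoidHom.range_comp]
  exact Subgroup.map_mono h

/-- **`ρ|_{Γ_L}` is residually absolutely irreducible iff `ρ̄|_{Γ_{F(ζ_p)}}` is absolutely
irreducible**, for any model `L ⊇ F` of `F(ζ_p)` and any reduction `τ = ρ̄` of `ρ` over `ℤ̄_p/𝔪`: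
`τ ∘ res` is a reduction of `ρ|_{Γ_L}` (`IsReductionOf.comp`), every reduction of a residually
absolutely irreducible representation is absolutely irreducible
(`IsReductionOf.isAbsIrreducible_of_isResiduallyAbsIrreducible`), and
`res(Γ_L) = Γ_{F(ζ_p)} = absGaloisGroupAdjoinRootsOfUnity F p`
(`range_absGaloisRestrict_eq_absGaloisGroupAdjoinRootsOfUnity`), so `τ ∘ res` and `τ|_{Γ_{F(ζ_p)}}`
have the same image. [cite: DarmonDiamondTaylor1995, §2.1, Prop. 2.6 (b)] -/
theorem FramedGaloisRep.isResiduallyAbsIrreducible_restrictField_iff_isAbsIrreducible_comp_subtype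
    (ρ : FramedGaloisRep F (PadicAlgCl p) n)
    {τ : absoluteGaloisGroup F →* GL (Fin n) (padicAlgClResidueField p)}
    (hτ : ρ.IsReductionOf (RingHom.id _) τ) (L : Type u) [Field L] [Algebra F L]
    [IsCyclotomicExtension {p} F L] :
    IsResiduallyAbsIrreducible (ρ.restrictField L) ↔
      IsAbsIrreducible (τ.comp (absGaloisGroupAdjoinRootsOfUnity F p).subtype) := by
  have hτL : GaloisRepresentations.IsReductionOf (RingHom.id _)
      ((ρ.restrictField L : FramedGaloisRep L (PadicAlgCl p) n) :
        absoluteGaloisGroup L →* GL (Fin n) (PadicAlgCl p))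
      (τ.comp (absGaloisRestrict F L).toMonoidHom) :=
    GaloisRepresentations.IsReductionOf.comp hτ (absGaloisRestrict F L).toMonoidHom
  have hrange : (τ.comp (absGaloisRestrict F L).toMonoidHom).range =
      (τ.comp (absGaloisGroupAdjoinRootsOfUnity F p).subtype).range := by
    rw [MonoidHom.range_comp, MonoidHom.range_comp, Subgroup.range_subtype]
    congr 1
    exact range_absGaloisRestrict_eq_absGaloisGroupAdjoinRootsOfUnity F L p
  constructor
  · intro h
    exact isAbsIrreducible_of_range_le' (hτL.isAbsIrreducible_of_isResiduallyAbsIrreducible h) hrange.le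
  · intro h
    exact ⟨_, hτL, isAbsIrreducible_of_range_le' h hrange.ge⟩

end Residual

/-! ### `-1` and `1` are not residually congruent (`p` odd) -/

/-- For `p` odd, `‖4‖ = 1` in `ℚ̄_p`. [folklore] -/
theorem PadicAlgCl.norm_four_eq_one {p : ℕ} [Fact p.Prime] (hp2 : p ≠ 2) :
    ‖(4 : PadicAlgCl p)‖ = 1 := by
  have hp : p.Prime := Fact.out
  have h4 : ¬ p ∣ 4 := fun h =>
    hp2 ((Nat.prime_dvd_prime_iff_eq hp Nat.prime_two).mp (hp.dvd_of_dvd_pow (show p ∣ 2 ^ 2 from h)))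
  have := PadicAlgCl.norm_natCast_eq_one_of_not_dvd h4
  rwa [Nat.cast_ofNat] at this

/-- The coefficient of `X` in `det(X - ε·1)` on `2 × 2` matrices is `-2ε` (`ε = ±1`): for `ε = -1`
it is `2`. [folklore] -/
theorem charpoly_coeff_one_neg_one_fin_two {A : Type*} [CommRing A] :
    ((-1 : Matrix (Fin 2) (Fin 2) A)).charpoly.coeff 1 = 2 := by
  have h := Matrix.trace_eq_neg_charpoly_coeff (-1 : Matrix (Fin 2) (Fin 2) A)
  rw [Fintype.card_fin, Matrix.trace_neg, Matrix.trace_one, Fintype.card_fin] at h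
  norm_num at h
  linear_combination -h

/-- The coefficient of `X` in `det(X - 1)` on `2 × 2` matrices is `-2`. [folklore] -/
theorem charpoly_coeff_one_one_fin_two {A : Type*} [CommRing A] :
    ((1 : Matrix (Fin 2) (Fin 2) A)).charpoly.coeff 1 = -2 := by
  have h := Matrix.trace_eq_neg_charpoly_coeff (1 : Matrix (Fin 2) (Fin 2) A)
  rw [Fintype.card_fin, Matrix.trace_one, Fintype.card_fin] at h
  norm_num at h
  linear_combination h

namespace FramedRep

/-- **`-1` and `1` are not residually congruent in `GL₂(ℚ̄_p)` for `p` odd**: if `ρ(σ) = -1` and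
`ρ'(σ) = 1` for some `σ`, then `ρ` and `ρ'` are not residually congruent — the coefficients of
`X` in `(X + 1)²` and `(X - 1)²` differ by `4`, a `p`-adic unit. [folklore] -/
theorem not_isResiduallyCongruent_of_apply_eq_neg_one {Γ : Type*} [Group Γ] [TopologicalSpace Γ]
    {p : ℕ} [Fact p.Prime] (hp2 : p ≠ 2) {ρ ρ' : FramedRep Γ (PadicAlgCl p) 2} {σ : Γ}
    (hρ : ρ σ = -1) (hρ' : ρ' σ = 1) : ¬ IsResiduallyCongruent ρ ρ' := by
  intro h
  have h1 := h σ 1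
  rw [hρ, hρ', Units.val_neg, Units.val_one, charpoly_coeff_one_neg_one_fin_two,
    charpoly_coeff_one_one_fin_two] at h1
  norm_num at h1
  rw [PadicAlgCl.norm_four_eq_one hp2] at h1
  exact lt_irrefl _ h1

end FramedRep

end Literature.NumberTheory.GaloisRepresentations

end
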